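import Literature.Probability.RandomPlanarGeometry.HexSAWBrickWallStripFugacityWidthOneComplexPerronData
import Literature.Probability.RandomPlanarGeometry.HexSAWBrickWallStripFugacityWidthOneComplexDecomposition
import Literature.Probability.RandomPlanarGeometry.HexSAWBrickWallStripFugacityWidthOneSeriesRing
import Literature.Analysis.Asymptotics.LinearRecurrenceLimitFormula
import Mathlib.Analysis.Calculus.MeanValue
import Mathlib.Analysis.Calculus.Deriv.Polynomial
import HarnessLib

/-!
# Complex two-term asymptotics of the width-one two-wall strip partition function near the real axis:
# `C_{1,2M+c}(ye^{it}, z) = A(t)·s(t)^M + O((M+1)Θ^M)` uniformly in `|t| < t₀`, with `‖A(t) − A₀‖ ≤ K|t|`, `A₀ > 0`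

Topic `Literature/Probability/RandomPlanarGeometry` (assembles `…WidthOneComplexPerronData.lean` (`exists_complexPerronData`: the Perron root `s(t)` of the
two-wall cubic at fugacity `ye^{it}` with `‖s(t) − s‖ ≤ L|t|` and a persistent cofactor gap `R′ < ‖s(t)‖`), `…WidthOneComplexDecomposition.lean`
(`d·C_{1,N+2} = u_{N+2} + e_{N+2}` over any ring, with the order-6/8 recurrences and `norm_ePart_le`), `…WidthOneSeriesRing.lean` (`map_stripZ₂C`) and
`Literature/Analysis/Asymptotics/LinearRecurrenceLimitFormula.lean` (`norm_parity_sub_limitFormula_mul_pow_le`: the parity two-term bound with the EXPLICIT,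
rational amplitude)).  Brick B6c of DOOR-ap5-g27 item 1 (the Berry–Esseen rate for the contact number): the bookkeeping that turns these into ONE uniform
statement.

* §1 Generic tools: `exists_norm_eval_le_of_norm_le` / `exists_norm_eval_sub_eval_le` (a complex polynomial is bounded and Lipschitz on a closed disc —
  compactness and the mean value inequality), `norm_ofReal_mul_cexp_sub_le` (`‖ye^{it} − y‖ ≤ |y|·|t|`).
* §2 `norm_le_of_rec_eight_sq_complex` — the `e`-part bound for ALL indices: `‖e_n‖ ≤ (n+1)η^n·Σ_{j<4}(‖e_j‖ + ‖e_{j+4}‖/‖ω‖)/η^j`, `η = ‖ω‖^{1/4}`.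
* §3 `map_twoWallUC`, `map_twoWallVC` (base change of the partial-fraction numerators) and ★ `exists_coeff_polynomials` — THE POLYNOMIAL TRICK: working over
  `R = ℂ[W]` and evaluating at `W = w`, the `u`- and `e`-coefficients at fugacity `(w, z)` are values `P_n(w)` of FIXED polynomials `P_n ∈ ℂ[W]`, for EVERY
  `w ∈ ℂ` simultaneously (decomposition + both recurrences); hence every datum of the asymptotics is bounded and Lipschitz in `w` on the disc `‖w‖ ≤ y`.
* §4 ★★★ `exists_complex_two_term` — for `y, z > 0` and every parity offset `c`: there are `A₀ ∈ ℂ`, `L, K ≥ 0`, `t₀ > 0`, `0 ≤ Θ < s − L t₀` (`s = μ₁(y,z)²`)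
  such that for every real `|t| < t₀` there are `s', A ∈ ℂ` with `F(s',t) = 0` (the two-wall cubic at fugacity `ye^{it}`), `‖s' − s‖ ≤ L|t|`,
  `‖A − A₀‖ ≤ K|t|`, and `‖C_{1,2M+c}(ye^{it}, z) − A·s'^M‖ ≤ K(M+1)Θ^M` for ALL `M`.
* §5 ★★★ `exists_complex_two_term_real_amplitude` — the same with `A₀` REAL and `0 < A₀`, and `C_{1,2M+c}(y,z)/s^M → A₀` (Fekete positivity
  `pos_of_tendsto_stripZ₂_one_parity`): at `t = 0` this is the real two-term asymptotics with rate, at `t ≠ 0` the input of the Berry–Esseen glue.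

## Sources
N. R. Beaton, M. Bousquet-Mélou, J. de Gier, H. Duminil-Copin, A. J. Guttmann, CMP 326 (2014), arXiv:1109.0358v5 §3.2 (p. 10: `C_{T,N}(y,z)`, Proposition 6;
p. 12: rationality of the strip series); R. P. Stanley, *Enumerative Combinatorics* I (2nd ed.) §4.1 Theorem 4.1.1 (iii); L. V. Ahlfors, *Complex Analysis*
(1979) Ch. 4 §3.3.  Lane statements (lane «pcv-sawmu», a-p5 g28); nothing is quoted AS PRINTED.
-/

noncomputable section

open Filter Complex Finset PowerSeries Metric Set
open Literature.Analysis Literature.Analysis.Asymptotics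
open Literature.Probability.LatticeModels Literature.Probability.Percolation
open scoped Topology

namespace Literature.Probability.RandomPlanarGeometry.SAW.HexBW

namespace WidthOneYZ

variable {y z : ℝ}

/-! ## §1 Generic tools: polynomials on a disc; the point `ye^{it}` -/

/-- A complex polynomial is bounded on the closed disc `‖w‖ ≤ ρ`. [cite: Ahlfors1979, Ch. 4 §3.3 (lane plumbing: continuity on a compact disc)] -/
theorem exists_norm_eval_le_of_norm_le (P : Polynomial ℂ) (ρ : ℝ) :
    ∃ B : ℝ, 0 ≤ B ∧ ∀ w : ℂ, ‖w‖ ≤ ρ → ‖P.eval w‖ ≤ B := by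
  obtain ⟨B, hB⟩ := (isCompact_closedBall (0 : ℂ) ρ).exists_bound_of_continuousOn P.continuous.continuousOn
  refine ⟨max B 0, le_max_right _ _, fun w hw => (hB w ?_).trans (le_max_left _ _)⟩
  simpa using hw

/-- A complex polynomial is Lipschitz on the closed disc `‖w‖ ≤ ρ` (mean value inequality on a convex set, with the derivative polynomial bounded on
the disc). [cite: Ahlfors1979, Ch. 4 §3.3 (lane plumbing)] -/
theorem exists_norm_eval_sub_eval_le (P : Polynomial ℂ) (ρ : ℝ) :
    ∃ K : ℝ, 0 ≤ K ∧ ∀ w₁ w₂ : ℂ, ‖w₁‖ ≤ ρ → ‖w₂‖ ≤ ρ → ‖P.eval w₁ - P.eval w₂‖ ≤ K * ‖w₁ - w₂‖ := by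
  obtain ⟨K, hK0, hK⟩ := exists_norm_eval_le_of_norm_le (Polynomial.derivative P) ρ
  refine ⟨K, hK0, fun w₁ w₂ h₁ h₂ => ?_⟩
  have h := Convex.norm_image_sub_le_of_norm_deriv_le (f := fun w => P.eval w) (s := closedBall (0 : ℂ) ρ) (x := w₂) (y := w₁)
    (fun x _ => P.differentiableAt) (fun x hx => by rw [Polynomial.deriv]; exact hK x (by simpa using hx))
    (convex_closedBall _ _) (by simpa using h₂) (by simpa using h₁)
  exact h

/-- `‖y·e^{it}‖ = |y|` and `‖y·e^{it} − y‖ ≤ |y|·|t|`. [cite: Ahlfors1979, Ch. 4 §3.3 (lane plumbing)] -/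
theorem norm_ofReal_mul_cexp_sub_le (y t : ℝ) :
    ‖(y : ℂ) * cexp ((t : ℂ) * I)‖ = |y| ∧ ‖(y : ℂ) * cexp ((t : ℂ) * I) - (y : ℂ)‖ ≤ |y| * |t| := by
  refine ⟨by rw [norm_mul, Complex.norm_real, Complex.norm_exp_ofReal_mul_I, mul_one, Real.norm_eq_abs], ?_⟩
  have h := Real.norm_exp_I_mul_ofReal_sub_one_le (x := t)
  rw [mul_comm I] at h
  calc ‖(y : ℂ) * cexp ((t : ℂ) * I) - (y : ℂ)‖ = ‖(y : ℂ)‖ * ‖cexp ((t : ℂ) * I) - 1‖ := by rw [← norm_mul]; ring_nf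
    _ ≤ |y| * |t| := by
        rw [Complex.norm_real, Real.norm_eq_abs]
        exact mul_le_mul_of_nonneg_left (by simpa [Real.norm_eq_abs] using h) (abs_nonneg y)

/-- Pointwise product rule for Lipschitz-at-a-point estimates: `‖a − a₀‖ ≤ Aτ`, `‖b − b₀‖ ≤ Bτ`, `‖a₀‖ ≤ α`, `‖b₀‖ ≤ β`, `0 ≤ τ ≤ 1` ⇒
`‖ab − a₀b₀‖ ≤ (αB + βA + AB)τ`. [cite: Ahlfors1979, Ch. 4 §3.3 (lane plumbing)] -/
private theorem lip_mul {a a₀ b b₀ : ℂ} {A B α β τ : ℝ} (hA : 0 ≤ A) (hB : 0 ≤ B) (hτ0 : 0 ≤ τ) (hτ1 : τ ≤ 1)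
    (ha : ‖a - a₀‖ ≤ A * τ) (hb : ‖b - b₀‖ ≤ B * τ) (hα : ‖a₀‖ ≤ α) (hβ : ‖b₀‖ ≤ β) :
    ‖a * b - a₀ * b₀‖ ≤ (α * B + β * A + A * B) * τ := by
  have e : a * b - a₀ * b₀ = (a - a₀) * (b - b₀) + a₀ * (b - b₀) + (a - a₀) * b₀ := by ring
  rw [e]
  have h1 : ‖(a - a₀) * (b - b₀)‖ ≤ A * τ * (B * τ) := by
    rw [norm_mul]; exact mul_le_mul ha hb (norm_nonneg _) (by positivity)
  have h2 : ‖a₀ * (b - b₀)‖ ≤ α * (B * τ) := by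
    rw [norm_mul]; exact mul_le_mul hα hb (norm_nonneg _) ((norm_nonneg _).trans hα)
  have h3 : ‖(a - a₀) * b₀‖ ≤ A * τ * β := by
    rw [norm_mul]; exact mul_le_mul ha hβ (norm_nonneg _) (by positivity)
  have hττ : τ * τ ≤ τ := by nlinarith
  calc ‖(a - a₀) * (b - b₀) + a₀ * (b - b₀) + (a - a₀) * b₀‖
      ≤ ‖(a - a₀) * (b - b₀)‖ + ‖a₀ * (b - b₀)‖ + ‖(a - a₀) * b₀‖ := norm_add₃_le
    _ ≤ A * τ * (B * τ) + α * (B * τ) + A * τ * β := by linarith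
    _ = A * B * (τ * τ) + (α * B + β * A) * τ := by ring
    _ ≤ A * B * τ + (α * B + β * A) * τ := by nlinarith [mul_nonneg hA hB]
    _ = (α * B + β * A + A * B) * τ := by ring

/-- Pointwise inverse rule: `‖a − a₀‖ ≤ Aτ ≤ ‖a₀‖/2`, `a₀ ≠ 0` ⇒ `a ≠ 0` and `‖a⁻¹ − a₀⁻¹‖ ≤ (2A/‖a₀‖²)τ`. [cite: Ahlfors1979, Ch. 4 §3.3 (lane plumbing)] -/
private theorem lip_inv {a a₀ : ℂ} {A τ : ℝ} (hA : 0 ≤ A) (hτ0 : 0 ≤ τ) (ha0 : a₀ ≠ 0) (ha : ‖a - a₀‖ ≤ A * τ)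
    (hsmall : A * τ ≤ ‖a₀‖ / 2) : a ≠ 0 ∧ ‖a₀‖ / 2 ≤ ‖a‖ ∧ ‖a⁻¹ - a₀⁻¹‖ ≤ (2 * A / ‖a₀‖ ^ 2) * τ := by
  have hn0 : 0 < ‖a₀‖ := norm_pos_iff.2 ha0
  have hlow : ‖a₀‖ / 2 ≤ ‖a‖ := by
    have := norm_sub_norm_le a₀ a
    rw [norm_sub_rev] at this
    linarith
  have hapos : 0 < ‖a‖ := lt_of_lt_of_le (by positivity) hlow
  have ha' : a ≠ 0 := norm_pos_iff.1 hapos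
  refine ⟨ha', hlow, ?_⟩
  rw [inv_sub_inv ha' ha0, norm_div, norm_mul, norm_sub_rev]
  rw [div_le_iff₀ (by positivity)]
  calc ‖a - a₀‖ ≤ A * τ := ha
    _ = (2 * A / ‖a₀‖ ^ 2) * τ * (‖a₀‖ / 2 * ‖a₀‖) := by field_simp
    _ ≤ (2 * A / ‖a₀‖ ^ 2) * τ * (‖a‖ * ‖a₀‖) := by gcongr

/-! ## §2 The `e`-part bound for all indices -/

/-- **The `e`-part is `O(n·‖ω‖^{n/4})` for ALL `n`**: if `e_{n+8} = 2ω e_{n+4} − ω² e_n` (`ω ∈ ℂ`, `ω ≠ 0`, `η = ‖ω‖^{1/4}`) then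
`‖e_n‖ ≤ (n+1)·η^n·Σ_{j<4}(‖e_j‖ + ‖e_{j+4}‖/‖ω‖)/η^j` (residues mod 4 and `norm_ePart_le`). [cite: Stanley2012EC1, §4.1 Theorem 4.1.1 (iii) (lane statement, complex data)] -/
theorem norm_le_of_rec_eight_sq_complex {ω : ℂ} (hω : ω ≠ 0) {e : ℕ → ℂ}
    (he : ∀ N, e (N + 8) = 2 * ω * e (N + 4) - ω ^ 2 * e N) (n : ℕ) :
    ‖e n‖ ≤ ((n : ℝ) + 1) * Real.sqrt (Real.sqrt ‖ω‖) ^ n *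
      ∑ j ∈ range 4, (‖e j‖ + ‖e (j + 4)‖ / ‖ω‖) / Real.sqrt (Real.sqrt ‖ω‖) ^ j := by
  have hω0 : 0 < ‖ω‖ := norm_pos_iff.2 hω
  set η := Real.sqrt (Real.sqrt ‖ω‖) with hη
  have hη0 : 0 < η := Real.sqrt_pos.2 (Real.sqrt_pos.2 hω0)
  have hη4 : η ^ 4 = ‖ω‖ := by
    rw [show (4 : ℕ) = 2 * 2 by norm_num, pow_mul, hη, Real.sq_sqrt (Real.sqrt_nonneg _), Real.sq_sqrt hω0.le]
  set j := n % 4 with hj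
  set k := n / 4 with hk
  have hn : n = 4 * k + j := by rw [hj, hk]; omega
  have hj4 : j < 4 := by rw [hj]; exact Nat.mod_lt _ (by norm_num)
  have hb := norm_ePart_le hω he j k
  rw [← hn] at hb
  have hterm : (‖e j‖ + ‖e (j + 4)‖ / ‖ω‖) / η ^ j ≤ ∑ i ∈ range 4, (‖e i‖ + ‖e (i + 4)‖ / ‖ω‖) / η ^ i :=
    Finset.single_le_sum (f := fun i => (‖e i‖ + ‖e (i + 4)‖ / ‖ω‖) / η ^ i)
      (fun i _ => by positivity) (Finset.mem_range.2 hj4)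
  have hk1 : ((k : ℝ) + 1) ≤ (n : ℝ) + 1 := by
    have : k ≤ n := by rw [hn]; omega
    exact_mod_cast Nat.add_le_add_right this 1
  have hwk : ‖ω‖ ^ k = η ^ n / η ^ j := by
    rw [eq_div_iff (pow_ne_zero _ hη0.ne'), ← hη4, ← pow_mul, ← pow_add, hn]
  calc ‖e n‖ ≤ ((k : ℝ) + 1) * ‖ω‖ ^ k * (‖e j‖ + ‖e (j + 4)‖ / ‖ω‖) := hb
    _ = ((k : ℝ) + 1) * η ^ n * ((‖e j‖ + ‖e (j + 4)‖ / ‖ω‖) / η ^ j) := by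
        rw [hwk]; field_simp
    _ ≤ ((n : ℝ) + 1) * η ^ n * ∑ i ∈ range 4, (‖e i‖ + ‖e (i + 4)‖ / ‖ω‖) / η ^ i := by
        gcongr

/-! ## §3 Base change of the partial-fraction numerators; the polynomial trick -/

section Map

variable {R S : Type*} [CommRing R] [CommRing S] (f : R →+* S)

/-- Ring homomorphisms act on the fugacities of the `U`-numerator. [cite: Stanley2012EC1, §4.1 (lane plumbing: base change)] -/
theorem map_twoWallUC (w v : R) : PowerSeries.map f (twoWallUC w v) = twoWallUC (f w) (f v) := by
  simp only [twoWallUC, pfU₀C, pfU₁C, pfU₂C, pfU₃C, pfU₄C, pfU₅C, map_add, map_sub, map_mul, map_pow, PowerSeries.map_C,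
    PowerSeries.map_X, map_ofNat]

/-- Ring homomorphisms act on the fugacities of the `V`-numerator. [cite: Stanley2012EC1, §4.1 (lane plumbing: base change)] -/
theorem map_twoWallVC (w v : R) : PowerSeries.map f (twoWallVC w v) = twoWallVC (f w) (f v) := by
  simp only [twoWallVC, pfV₀C, pfV₁C, pfV₂C, pfV₃C, pfV₄C, pfV₅C, pfV₆C, pfV₇C, map_add, map_sub, map_mul, map_pow, map_neg,
    PowerSeries.map_C, PowerSeries.map_X, map_ofNat]

end Map

/-- ★ **THE POLYNOMIAL TRICK.**  For every `v ∈ ℂ` there are polynomials `P_n, Q_n ∈ ℂ[W]` (`n ∈ ℕ`) such that for EVERY `w ∈ ℂ`: the decomposition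
`((w−v)² + 2w + 2v + 1)²·C_{1,N+2}(w,v) = P_{N+2}(w) + Q_{N+2}(w)`, the order-6 recurrence `P_{N+6}(w) = (w+v)P_{N+4}(w) − wv·P_{N+2}(w) + wv·P_N(w)` and the
order-8 recurrence `Q_{N+8}(w) = 2wv·Q_{N+4}(w) − (wv)²Q_N(w)` hold (the `u`- and `e`-parts at the universal fugacity `W` over `R = ℂ[W]`, evaluated at `W = w`:
`stripZ₂C_coeff_decomposition` / `_uPart_rec` / `_ePart_rec` over `R` and `map_stripZ₂C`).  So every datum of the two-term asymptotics is a polynomial in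
the fugacity. [cite: Stanley2012EC1, §4.1 Theorem 4.1.1 (iii) (lane statement); BeatonBousquetMelouDeGierDuminilCopinGuttmann2014, §3.2 (arXiv v5 p. 12)] -/
theorem exists_coeff_polynomials (v : ℂ) :
    ∃ P Q : ℕ → Polynomial ℂ, ∀ w : ℂ,
      (∀ N : ℕ, ((w - v) ^ 2 + 2 * w + 2 * v + 1) ^ 2 * stripZ₂C 1 (N + 2) w v = (P (N + 2)).eval w + (Q (N + 2)).eval w) ∧
      (∀ N : ℕ, (P (N + 6)).eval w = (w + v) * (P (N + 4)).eval w - w * v * (P (N + 2)).eval w + w * v * (P N).eval w) ∧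
      (∀ N : ℕ, (Q (N + 8)).eval w = 2 * (w * v) * (Q (N + 4)).eval w - (w * v) ^ 2 * (Q N).eval w) := by
  set W : Polynomial ℂ := Polynomial.X with hW
  set vR : Polynomial ℂ := Polynomial.C v with hvR
  obtain ⟨iq, iQ, hq, hQ⟩ := exists_twoWall_inverses W vR
  refine ⟨fun n => coeff n (twoWallUC W vR * iq), fun n => coeff n (twoWallVC W vR * iQ), fun w => ?_⟩
  set φ : Polynomial ℂ →+* ℂ := Polynomial.evalRingHom w with hφ
  have hφW : φ W = w := by simp [hφ, hW]
  have hφv : φ vR = v := by simp [hφ, hvR]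
  have hW' : Polynomial.eval w W = w := by simp [hW]
  have hv' : Polynomial.eval w vR = v := by simp [hvR]
  have hφe : ∀ p : Polynomial ℂ, φ p = p.eval w := fun p => rfl
  refine ⟨fun N => ?_, fun N => ?_, fun N => ?_⟩
  · have h := congrArg φ (stripZ₂C_coeff_decomposition hq hQ N)
    rw [map_mul, map_stripZ₂C, map_add, hφW, hφv] at h
    simpa [hW', hv', hφe] using h
  · have h := congrArg φ (stripZ₂C_uPart_rec (w := W) (v := vR) hq N)
    simpa [hW', hv', hφe] using h
  · have h := congrArg φ (stripZ₂C_ePart_rec (w := W) (v := vR) hQ N)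
    simpa [hW', hv', hφe] using h

/-! ## §4 ★★★ The uniform complex two-term asymptotics with Lipschitz amplitude -/

/-- Window bookkeeping: `τ ≤ t₀ ≤ D/(2(K+1))` ⇒ `Kτ ≤ D/2`. [cite: Ahlfors1979, Ch. 4 §3.3 (lane plumbing)] -/
private theorem smallness {K D τ t₀ : ℝ} (hK : 0 ≤ K) (hD : 0 < D) (hτ : τ ≤ t₀) (ht₀ : t₀ ≤ D / (2 * (K + 1))) :
    K * τ ≤ D / 2 := by
  have h1 : K * τ ≤ K * (D / (2 * (K + 1))) := mul_le_mul_of_nonneg_left (hτ.trans ht₀) hK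
  have h2 : K * (D / (2 * (K + 1))) = D / 2 * (K / (K + 1)) := by field_simp
  have h3 : K / (K + 1) ≤ 1 := by rw [div_le_one (by positivity)]; linarith only []
  have h4 : D / 2 * (K / (K + 1)) ≤ D / 2 := mul_le_of_le_one_right (by positivity) h3
  linarith only [h1, h2, h3, h4]

/-- The cofactor of the sextic cubic at its real Perron root is `F(s) = (s−y)(s−z) + s(s−z) + s(s−y)`:
`s² + (s − y − z)s + yz/s = F(s)` (`s(s−y)(s−z) = yz`). [cite: BeatonBousquetMelouDeGierDuminilCopinGuttmann2014, §3.2 Proposition 6 (arXiv v5 p. 10; lane computation)] -/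
private theorem cofactor_at_root (hy : 0 < y) (hz : 0 < z) :
    ((stripMuY₂ 1 y z ^ 2 : ℝ) : ℂ) ^ 2 + (((stripMuY₂ 1 y z ^ 2 : ℝ) : ℂ) - (y : ℂ) - (z : ℂ)) * ((stripMuY₂ 1 y z ^ 2 : ℝ) : ℂ)
        + (y : ℂ) * (z : ℂ) / ((stripMuY₂ 1 y z ^ 2 : ℝ) : ℂ)
      = (((stripMuY₂ 1 y z ^ 2 - y) * (stripMuY₂ 1 y z ^ 2 - z) + stripMuY₂ 1 y z ^ 2 * (stripMuY₂ 1 y z ^ 2 - z)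
          + stripMuY₂ 1 y z ^ 2 * (stripMuY₂ 1 y z ^ 2 - y) : ℝ) : ℂ) := by
  obtain ⟨hys, -⟩ := lt_stripMuY₂_one_sq₂ hy hz
  have hsex := stripMuY₂_one_sq_poly_eq hy hz
  set s := stripMuY₂ 1 y z ^ 2 with hs
  have hs0 : (s : ℂ) ≠ 0 := by exact_mod_cast (hy.trans hys).ne'
  have hsexC : (s : ℂ) * ((s : ℂ) - y) * ((s : ℂ) - z) = (y : ℂ) * z := by exact_mod_cast hsex
  push_cast
  field_simp
  linear_combination (-1 : ℂ) * hsexC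

set_option maxHeartbeats 400000 in
-- budget line: ONE long bookkeeping proof (explicit constants, no search tactics); the default budget covers ≈ 3/4 of it.
/-- ★★★ **COMPLEX TWO-TERM ASYMPTOTICS NEAR THE REAL AXIS, UNIFORM, WITH LIPSCHITZ AMPLITUDE.**  For `y, z > 0`, `s = μ₁(y,z)²` and every parity
offset `c` there are `A₀ ∈ ℂ`, `L, K ≥ 0`, `t₀ > 0` and `0 ≤ Θ < s − L·t₀` such that for every real `t` with `|t| < t₀` there are `s', A ∈ ℂ` with:
`F(s', t) = 0` (the two-wall cubic at fugacity `ye^{it}`), `‖s' − s‖ ≤ L|t|` (so `Θ < ‖s'‖`), `‖A − A₀‖ ≤ K|t|`, and for ALL `M`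
`‖C_{1,2M+c}(ye^{it}, z) − A·s'^M‖ ≤ K(M+1)Θ^M`.
(`u`-part: `norm_parity_sub_limitFormula_mul_pow_le` at the complex Perron data of `exists_complexPerronData`, with the amplitude RATIONAL in
`(s', ye^{it}, u_c, u_{c+2}, u_{c+4})`; `e`-part: `norm_le_of_rec_eight_sq_complex` with `‖ω‖ = yz < s²`; all data polynomial in the fugacity by
`exists_coeff_polynomials`, hence bounded and Lipschitz on the circle `‖w‖ = y`; `Θ = max(R′, √(yz))`.)
[cite: BeatonBousquetMelouDeGierDuminilCopinGuttmann2014, §3.2 Proposition 6 (arXiv v5 p. 10; lane statement); Stanley2012EC1, §4.1 Theorem 4.1.1 (iii); Ahlfors1979, Ch. 4 §3.3] -/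
theorem exists_complex_two_term (hy : 0 < y) (hz : 0 < z) (c : ℕ) :
    ∃ A₀ : ℂ, ∃ L t₀ K Θ : ℝ, 0 ≤ L ∧ 0 < t₀ ∧ 0 ≤ K ∧ 0 ≤ Θ ∧ Θ < stripMuY₂ 1 y z ^ 2 - L * t₀ ∧
      ∀ t : ℝ, |t| < t₀ → ∃ s' A : ℂ, twoWallCubic y z s' t = 0 ∧
        ‖s' - ((stripMuY₂ 1 y z ^ 2 : ℝ) : ℂ)‖ ≤ L * |t| ∧ ‖A - A₀‖ ≤ K * |t| ∧
        ∀ M : ℕ, ‖stripZ₂C 1 (2 * M + c) ((y : ℂ) * cexp ((t : ℂ) * I)) (z : ℂ) - A * s' ^ M‖ ≤ K * ((M : ℝ) + 1) * Θ ^ M := by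
  -- === the real data ===
  obtain ⟨hys, hzs⟩ := lt_stripMuY₂_one_sq₂ hy hz
  obtain ⟨hR0, hRs⟩ := quadRootBound_cofactor_lt hy hz
  have hcof := cofactor_at_root hy hz
  obtain ⟨t₁, ht₁, HP⟩ := exists_complexPerronData hy hz
  set s := stripMuY₂ 1 y z ^ 2 with hs
  have hs0 : 0 < s := hy.trans hys
  set R₀ := quadRootBound (s - y - z) (y * z / s) with hR₀
  set D := (s - y) * (s - z) + s * (s - z) + s * (s - y) with hD
  have hD0 : 0 < D := by
    have := mul_pos (sub_pos.2 hys) (sub_pos.2 hzs)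
    have := mul_pos hs0 (sub_pos.2 hzs)
    have := mul_pos hs0 (sub_pos.2 hys)
    rw [hD]; linarith
  set R' := R₀ + (s - R₀) / 2 with hR'
  have hR'0 : 0 < R' := by rw [hR']; linarith
  have hR's : R' < s := by rw [hR']; linarith
  set L := 2 * (y * (s * (s - z) + z)) / D with hL
  have hL0 : 0 ≤ L := by
    rw [hL]; exact div_nonneg (by nlinarith [mul_pos hs0 (sub_pos.2 hzs)]) hD0.le
  clear_value L D
  -- the e-part scale
  set Θe := Real.sqrt (y * z) with hΘe
  have hΘe0 : 0 ≤ Θe := Real.sqrt_nonneg _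
  have hΘes : Θe < s := by
    rw [hΘe, Real.sqrt_lt' hs0]; nlinarith
  set η := Real.sqrt Θe with hη
  have hyz0 : 0 < y * z := mul_pos hy hz
  have hΘe0' : 0 < Θe := Real.sqrt_pos.2 hyz0
  have hη0 : 0 < η := Real.sqrt_pos.2 hΘe0'
  have hη2 : η ^ 2 = Θe := Real.sq_sqrt hΘe0
  set Θ := max R' Θe with hΘ
  have hΘ0 : 0 ≤ Θ := le_trans hΘe0 (le_max_right _ _)
  have hΘs : Θ < s := max_lt hR's hΘes
  have hR'Θ : R' ≤ Θ := le_max_left _ _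
  have hΘeΘ : Θe ≤ Θ := le_max_right _ _
  clear_value s R₀ R' Θe η Θ
  -- === the polynomial data ===
  obtain ⟨P, Q, HPQ⟩ := exists_coeff_polynomials (z : ℂ)
  set PΔ : Polynomial ℂ := ((Polynomial.X - Polynomial.C (z : ℂ)) ^ 2 + 2 * Polynomial.X + 2 * Polynomial.C (z : ℂ) + 1) ^ 2 with hPΔ
  have hPΔe : ∀ w : ℂ, PΔ.eval w = ((w - z) ^ 2 + 2 * w + 2 * z + 1) ^ 2 := by
    intro w; simp [hPΔ]
  obtain ⟨B₀, hB₀0, hB₀⟩ := exists_norm_eval_le_of_norm_le (P (2 * 0 + c)) y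
  obtain ⟨B₁, hB₁0, hB₁⟩ := exists_norm_eval_le_of_norm_le (P (2 * 1 + c)) y
  obtain ⟨B₂, hB₂0, hB₂⟩ := exists_norm_eval_le_of_norm_le (P (2 * 2 + c)) y
  obtain ⟨K₀, hK₀0, hK₀⟩ := exists_norm_eval_sub_eval_le (P (2 * 0 + c)) y
  obtain ⟨K₁, hK₁0, hK₁⟩ := exists_norm_eval_sub_eval_le (P (2 * 1 + c)) y
  obtain ⟨K₂, hK₂0, hK₂⟩ := exists_norm_eval_sub_eval_le (P (2 * 2 + c)) y
  obtain ⟨KΔ, hKΔ0, hKΔ⟩ := exists_norm_eval_sub_eval_le PΔ y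
  obtain ⟨Be, hBe0, hBe⟩ : ∃ Be : ℝ, 0 ≤ Be ∧ ∀ j ∈ Finset.range 8, ∀ w : ℂ, ‖w‖ ≤ y → ‖(Q j).eval w‖ ≤ Be := by
    choose B hB0 hB using fun j => exists_norm_eval_le_of_norm_le (Q j) y
    exact ⟨∑ j ∈ Finset.range 8, B j, Finset.sum_nonneg fun j _ => hB0 j,
      fun j hj w hw => (hB j w hw).trans (Finset.single_le_sum (fun i _ => hB0 i) hj)⟩
  -- === constants ===
  set Δ₀ : ℝ := ((y - z) ^ 2 + 2 * y + 2 * z + 1) ^ 2 with hΔ₀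
  have hΔ₀0 : 0 < Δ₀ := by rw [hΔ₀]; positivity
  set Ke : ℝ := ∑ j ∈ Finset.range 4, (Be + Be / (y * z)) / η ^ j with hKe
  have hKe0 : 0 ≤ Ke := by rw [hKe]; exact Finset.sum_nonneg fun j _ => by positivity
  clear_value Ke
  set Ke' : ℝ := ((c : ℝ) + 2) * η ^ c * Ke with hKe'
  have hKe'0 : 0 ≤ Ke' := by rw [hKe']; positivity
  clear_value Ke'
  set Ku : ℝ := (B₁ + (s + 1) * B₀ + (B₂ + (s + 1) * B₁) / R') * ((s + 1) / ((s - R') / 2) ^ 2) with hKu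
  have hKu0 : 0 ≤ Ku := by
    have : 0 < (s - R') / 2 := by linarith
    rw [hKu]; positivity
  clear_value Ku
  -- Lipschitz constants of the amplitude chain
  set Kκ : ℝ := y * z * (2 * L / s ^ 2) + 1 / s * (z * y) + z * y * (2 * L / s ^ 2) with hKκ
  have hKκ0 : 0 ≤ Kκ := by rw [hKκ]; positivity
  clear_value Kκ
  set KNum : ℝ := K₂ * y + ((s + y + z) * (K₁ * y) + B₁ * (L + y) + (L + y) * (K₁ * y))
    + (y * z / s * (K₀ * y) + B₀ * Kκ + Kκ * (K₀ * y)) with hKNum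
  have hKNum0 : 0 ≤ KNum := by rw [hKNum]; positivity
  clear_value KNum
  set KDen : ℝ := (s * (2 * L + y) + (2 * s + y + z) * L + L * (2 * L + y)) + Kκ with hKDen
  have hKDen0 : 0 ≤ KDen := by rw [hKDen]; positivity
  clear_value KDen
  set NB : ℝ := B₂ + (s + y + z) * B₁ + y * z / s * B₀ with hNB
  have hNB0 : 0 ≤ NB := by rw [hNB]; positivity
  clear_value NB
  set KLc : ℝ := NB * (2 * KDen / D ^ 2) + 1 / D * KNum + KNum * (2 * KDen / D ^ 2) with hKLc
  have hKLc0 : 0 ≤ KLc := by rw [hKLc]; positivity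
  clear_value KLc
  set KA : ℝ := NB / D * (2 * (KΔ * y) / Δ₀ ^ 2) + 1 / Δ₀ * KLc + KLc * (2 * (KΔ * y) / Δ₀ ^ 2) with hKA
  have hKA0 : 0 ≤ KA := by rw [hKA]; positivity
  clear_value KA
  -- the base amplitude
  set ub₀ : ℂ := (P (2 * 0 + c)).eval (y : ℂ) with hub₀
  set ub₁ : ℂ := (P (2 * 1 + c)).eval (y : ℂ) with hub₁
  set ub₂ : ℂ := (P (2 * 2 + c)).eval (y : ℂ) with hub₂
  set Num₀ : ℂ := ub₂ + ((s : ℂ) - y - z) * ub₁ + (y : ℂ) * z / (s : ℂ) * ub₀ with hNum₀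
  set A₀ : ℂ := Num₀ / (D : ℂ) / (Δ₀ : ℂ) with hA₀
  set K : ℝ := 2 * (Ku + Ke') / Δ₀ + (stripZ₂ 1 c y z + ‖A₀‖ + KA) + KA with hK
  have hK0 : 0 ≤ K := by
    have := stripZ₂_pos 1 c hy hz
    have := norm_nonneg A₀
    rw [hK]; positivity
  clear_value K Δ₀ PΔ ub₀ ub₁ ub₂ Num₀ A₀
  -- the time window
  have hsΘ : 0 < s - Θ := sub_pos.2 hΘs
  obtain ⟨t₀, ht₀0, ht₀1, ht₀L, ht₀Θ, ht₀D, ht₀Δ⟩ : ∃ t₀ : ℝ, 0 < t₀ ∧ t₀ ≤ t₁ ∧ t₀ ≤ 1 / (L + 1) ∧ t₀ ≤ (s - Θ) / (2 * (L + 1)) ∧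
      t₀ ≤ D / (2 * (KDen + 1)) ∧ t₀ ≤ Δ₀ / (2 * (KΔ * y + 1)) := by
    refine ⟨min t₁ (min (1 / (L + 1)) (min ((s - Θ) / (2 * (L + 1))) (min (D / (2 * (KDen + 1))) (Δ₀ / (2 * (KΔ * y + 1)))))),
      ?_, min_le_left _ _, ?_, ?_, ?_, ?_⟩
    · exact lt_min ht₁ (lt_min (by positivity) (lt_min (by positivity) (lt_min (by positivity) (by positivity))))
    · exact le_trans (min_le_right _ _) (min_le_left _ _)
    · exact le_trans (min_le_right _ _) (le_trans (min_le_right _ _) (min_le_left _ _))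
    · exact le_trans (min_le_right _ _) (le_trans (min_le_right _ _) (le_trans (min_le_right _ _) (min_le_left _ _)))
    · exact le_trans (min_le_right _ _) (le_trans (min_le_right _ _) (le_trans (min_le_right _ _) (min_le_right _ _)))
  have hLfrac : L / (2 * (L + 1)) ≤ 1 / 2 := by
    rw [div_le_iff₀ (by positivity)]; linarith only [hL0]
  have hLt₀' : L * t₀ ≤ (s - Θ) / 2 := by
    have h1 : L * t₀ ≤ L * ((s - Θ) / (2 * (L + 1))) := mul_le_mul_of_nonneg_left ht₀Θ hL0
    have h2 : L * ((s - Θ) / (2 * (L + 1))) = (s - Θ) * (L / (2 * (L + 1))) := by ring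
    have h3 : (s - Θ) * (L / (2 * (L + 1))) ≤ (s - Θ) * (1 / 2) := mul_le_mul_of_nonneg_left hLfrac hsΘ.le
    linarith only [h1, h2, h3]
  have hLt₀ : L * t₀ < s - Θ := by linarith only [hLt₀', hsΘ]
  have hΘfin : Θ < s - L * t₀ := by linarith only [hLt₀]
  refine ⟨A₀, L, t₀, K, Θ, hL0, ht₀0, hK0, hΘ0, hΘfin, fun t ht => ?_⟩
  -- === fix t ===
  set τ := |t| with hτ
  have hτ0 : 0 ≤ τ := by rw [hτ]; exact abs_nonneg t
  have hτt₀ : τ ≤ t₀ := ht.le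
  clear_value τ
  have hτ1 : τ ≤ 1 := by
    have : 1 / (L + 1) ≤ 1 := by rw [div_le_one (by positivity)]; linarith only [hL0]
    linarith only [this, hτt₀, ht₀L]
  have hLτ1 : L * τ ≤ 1 := by
    have h1 : L * τ ≤ L * (1 / (L + 1)) := mul_le_mul_of_nonneg_left (hτt₀.trans ht₀L) hL0
    have h2 : L * (1 / (L + 1)) ≤ 1 := by
      rw [← mul_div_assoc, mul_one, div_le_one (by positivity)]; linarith only [hL0]
    linarith only [h1, h2]
  have hLτ : L * τ ≤ (s - Θ) / 2 := by
    have := mul_le_mul_of_nonneg_left hτt₀ hL0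
    linarith only [this, hLt₀']
  have ht' : |t| < t₁ := by rw [← hτ]; exact lt_of_lt_of_le ht ht₀1
  obtain ⟨s', hF, hs'0, hdisp, hnorm, hroots⟩ := HP t ht'
  have hdisp' : ‖s' - (s : ℂ)‖ ≤ L * τ := by rw [hτ]; exact hdisp
  set w : ℂ := (y : ℂ) * cexp ((t : ℂ) * I) with hw
  obtain ⟨hwn, hwy⟩ := norm_ofReal_mul_cexp_sub_le y t
  rw [← hw, abs_of_pos hy] at hwn hwy
  rw [← hτ] at hwy
  have hwle : ‖w‖ ≤ y := hwn.le
  have hyle : ‖(y : ℂ)‖ ≤ y := by rw [Complex.norm_real, Real.norm_of_nonneg hy.le]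
  obtain ⟨Hdec, Hu, He⟩ := HPQ w
  clear_value w
  obtain ⟨u, hu⟩ : ∃ u : ℕ → ℂ, ∀ n, u n = (P n).eval w := ⟨_, fun n => rfl⟩
  obtain ⟨e, he⟩ : ∃ e : ℕ → ℂ, ∀ n, e n = (Q n).eval w := ⟨_, fun n => rfl⟩
  -- norms of s'
  have hsn : ‖(s : ℂ)‖ = s := by rw [Complex.norm_real, Real.norm_of_nonneg hs0.le]
  have hs'le : ‖s'‖ ≤ s + 1 := by
    have h1 : ‖s'‖ ≤ ‖(s : ℂ)‖ + ‖s' - (s : ℂ)‖ := by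
      have := norm_add_le (s : ℂ) (s' - (s : ℂ)); rwa [add_sub_cancel] at this
    rw [hsn] at h1
    linarith only [h1, hdisp', hLτ1]
  have hs'ge : s - L * τ ≤ ‖s'‖ := by
    have h1 : ‖(s : ℂ)‖ ≤ ‖s'‖ + ‖s' - (s : ℂ)‖ := by
      have h := norm_add_le s' ((s : ℂ) - s'); rw [add_sub_cancel] at h; rwa [norm_sub_rev] at h
    rw [hsn] at h1
    linarith only [h1, hdisp']
  have hgap : (s - R') / 2 ≤ ‖s'‖ - R' := by linarith only [hs'ge, hLτ, hR'Θ]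
  -- === the u-part ===
  have hcubic : s' * (s' - (y : ℂ) * cexp ((t : ℂ) * I)) * (s' - (z : ℂ)) = (y : ℂ) * cexp ((t : ℂ) * I) * (z : ℂ) :=
    (twoWallCubic_eq_zero_iff y z s' t).1 hF
  have hurec : ∀ N, u (N + 6) = (w + (z : ℂ)) * u (N + 4) - w * (z : ℂ) * u (N + 2) + w * (z : ℂ) * u N := fun N => by
    simp only [hu]; exact Hu N
  have hroots' : ∀ σ : ℂ, σ ^ 2 + (s' - w - (z : ℂ)) * σ + w * (z : ℂ) / s' = 0 → ‖σ‖ ≤ R' := hroots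
  have hU := norm_parity_sub_limitFormula_mul_pow_le (e := u) hurec hs'0 (by rw [hw]; exact hcubic) hR'0 hnorm hroots' c
  obtain ⟨Lc, hLc⟩ : ∃ Lc : ℂ, Lc = (u (2 * 2 + c) + (s' - w - (z : ℂ)) * u (2 * 1 + c) + w * (z : ℂ) / s' * u (2 * 0 + c))
    / (s' ^ 2 + (s' - w - (z : ℂ)) * s' + w * (z : ℂ) / s') := ⟨_, rfl⟩
  simp only [← hLc] at hU
  have hb0w : ‖u (2 * 0 + c)‖ ≤ B₀ := by rw [hu]; exact hB₀ w hwle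
  have hb1w : ‖u (2 * 1 + c)‖ ≤ B₁ := by rw [hu]; exact hB₁ w hwle
  have hb2w : ‖u (2 * 2 + c)‖ ≤ B₂ := by rw [hu]; exact hB₂ w hwle
  have hUb : ∀ M : ℕ, ‖u (2 * M + c) - Lc * s' ^ M‖ ≤ Ku * ((M : ℝ) + 1) * R' ^ M := by
    intro M
    have h := hU M
    have h1 : ‖u (2 * 1 + c) - s' * u (2 * 0 + c)‖ ≤ B₁ + (s + 1) * B₀ := by
      refine (norm_sub_le _ _).trans ?_
      rw [norm_mul]
      have := mul_le_mul hs'le hb0w (norm_nonneg _) (by positivity)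
      linarith only [this, hb1w]
    have h2 : ‖u (2 * 2 + c) - s' * u (2 * 1 + c)‖ ≤ B₂ + (s + 1) * B₁ := by
      refine (norm_sub_le _ _).trans ?_
      rw [norm_mul]
      have := mul_le_mul hs'le hb1w (norm_nonneg _) (by positivity)
      linarith only [this, hb2w]
    have hg0 : 0 < (s - R') / 2 := by linarith only [hR's]
    have h3 : ‖s'‖ / (‖s'‖ - R') ^ 2 ≤ (s + 1) / ((s - R') / 2) ^ 2 := by
      have hpos : 0 < (‖s'‖ - R') ^ 2 := by
        have : 0 < ‖s'‖ - R' := lt_of_lt_of_le hg0 hgap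
        positivity
      rw [div_le_div_iff₀ hpos (by positivity)]
      have h4 : ((s - R') / 2) ^ 2 ≤ (‖s'‖ - R') ^ 2 := pow_le_pow_left₀ hg0.le hgap 2
      calc ‖s'‖ * ((s - R') / 2) ^ 2 ≤ (s + 1) * ((s - R') / 2) ^ 2 := mul_le_mul_of_nonneg_right hs'le (sq_nonneg _)
        _ ≤ (s + 1) * (‖s'‖ - R') ^ 2 := mul_le_mul_of_nonneg_left h4 (by linarith only [hs0])
    have hpre : (‖u (2 * 1 + c) - s' * u (2 * 0 + c)‖ + ‖u (2 * 2 + c) - s' * u (2 * 1 + c)‖ / R')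
        * (‖s'‖ / (‖s'‖ - R') ^ 2) ≤ Ku := by
      rw [hKu]
      have hA : ‖u (2 * 1 + c) - s' * u (2 * 0 + c)‖ + ‖u (2 * 2 + c) - s' * u (2 * 1 + c)‖ / R'
          ≤ B₁ + (s + 1) * B₀ + (B₂ + (s + 1) * B₁) / R' :=
        add_le_add h1 (div_le_div_of_nonneg_right h2 hR'0.le)
      have hn1 : 0 ≤ ‖s'‖ / (‖s'‖ - R') ^ 2 := div_nonneg (norm_nonneg _) (sq_nonneg _)
      have hn2 : 0 ≤ B₁ + (s + 1) * B₀ + (B₂ + (s + 1) * B₁) / R' := by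
        have hs1 : 0 ≤ s + 1 := by linarith only [hs0]
        exact add_nonneg (add_nonneg hB₁0 (mul_nonneg hs1 hB₀0)) (div_nonneg (add_nonneg hB₂0 (mul_nonneg hs1 hB₁0)) hR'0.le)
      exact mul_le_mul hA h3 hn1 hn2
    calc ‖u (2 * M + c) - Lc * s' ^ M‖
        ≤ (‖u (2 * 1 + c) - s' * u (2 * 0 + c)‖ + ‖u (2 * 2 + c) - s' * u (2 * 1 + c)‖ / R') * ((M : ℝ) + 1) * R' ^ M
            * (‖s'‖ / (‖s'‖ - R') ^ 2) := h
      _ = (‖u (2 * 1 + c) - s' * u (2 * 0 + c)‖ + ‖u (2 * 2 + c) - s' * u (2 * 1 + c)‖ / R')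
            * (‖s'‖ / (‖s'‖ - R') ^ 2) * (((M : ℝ) + 1) * R' ^ M) := by ring
      _ ≤ Ku * (((M : ℝ) + 1) * R' ^ M) :=
          mul_le_mul_of_nonneg_right hpre (mul_nonneg (by positivity) (pow_nonneg hR'0.le _))
      _ = Ku * ((M : ℝ) + 1) * R' ^ M := by ring
  -- === the e-part ===
  have hωn : ‖w * (z : ℂ)‖ = y * z := by rw [norm_mul, hwn, Complex.norm_real, Real.norm_of_nonneg hz.le]
  have hω : w * (z : ℂ) ≠ 0 := by
    intro h0; rw [h0, norm_zero] at hωn; linarith only [hωn, hyz0]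
  have herec : ∀ N, e (N + 8) = 2 * (w * (z : ℂ)) * e (N + 4) - (w * (z : ℂ)) ^ 2 * e N := fun N => by
    simp only [he]; exact He N
  have hEb : ∀ M : ℕ, ‖e (2 * M + c)‖ ≤ Ke' * ((M : ℝ) + 1) * Θe ^ M := by
    intro M
    have h := norm_le_of_rec_eight_sq_complex hω herec (2 * M + c)
    rw [hωn, ← hΘe, ← hη] at h
    have hsum : ∑ j ∈ Finset.range 4, (‖e j‖ + ‖e (j + 4)‖ / (y * z)) / η ^ j ≤ Ke := by
      rw [hKe]
      refine Finset.sum_le_sum fun j hj => ?_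
      have hj4 : j < 4 := Finset.mem_range.1 hj
      have hej : ‖e j‖ ≤ Be := by rw [he]; exact hBe j (Finset.mem_range.2 (by omega)) w hwle
      have hej4 : ‖e (j + 4)‖ ≤ Be := by rw [he]; exact hBe (j + 4) (Finset.mem_range.2 (by omega)) w hwle
      exact div_le_div_of_nonneg_right (add_le_add hej (div_le_div_of_nonneg_right hej4 hyz0.le)) (pow_nonneg hη0.le _)
    have hpow : η ^ (2 * M + c) = η ^ c * Θe ^ M := by rw [pow_add, pow_mul, hη2, mul_comm]
    have hcnt : ((2 * M + c : ℕ) : ℝ) + 1 ≤ ((c : ℝ) + 2) * ((M : ℝ) + 1) := by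
      push_cast; nlinarith only [Nat.cast_nonneg (α := ℝ) M, Nat.cast_nonneg (α := ℝ) c]
    calc ‖e (2 * M + c)‖ ≤ (((2 * M + c : ℕ) : ℝ) + 1) * η ^ (2 * M + c) *
          ∑ j ∈ Finset.range 4, (‖e j‖ + ‖e (j + 4)‖ / (y * z)) / η ^ j := h
      _ ≤ (((c : ℝ) + 2) * ((M : ℝ) + 1)) * (η ^ c * Θe ^ M) * Ke := by
          rw [hpow]
          have hm0 : 0 ≤ η ^ c * Θe ^ M := mul_nonneg (pow_nonneg hη0.le _) (pow_nonneg hΘe0 _)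
          have hsum0 : 0 ≤ ∑ j ∈ Finset.range 4, (‖e j‖ + ‖e (j + 4)‖ / (y * z)) / η ^ j :=
            Finset.sum_nonneg fun j _ =>
              div_nonneg (add_nonneg (norm_nonneg _) (div_nonneg (norm_nonneg _) hyz0.le)) (pow_nonneg hη0.le _)
          have hc0 : 0 ≤ ((c : ℝ) + 2) * ((M : ℝ) + 1) := by positivity
          exact mul_le_mul (mul_le_mul_of_nonneg_right hcnt hm0) hsum (hsum0) (mul_nonneg hc0 hm0)
      _ = Ke' * ((M : ℝ) + 1) * Θe ^ M := by rw [hKe']; ring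
  -- === the amplitude; main bound for M ≥ 1 ===
  have hΔw : PΔ.eval w = ((w - z) ^ 2 + 2 * w + 2 * z + 1) ^ 2 := hPΔe w
  have hΔy : PΔ.eval (y : ℂ) = (Δ₀ : ℂ) := by rw [hPΔe, hΔ₀]; push_cast; ring
  have hΔlip : ‖((w - z) ^ 2 + 2 * w + 2 * z + 1) ^ 2 - (Δ₀ : ℂ)‖ ≤ KΔ * y * τ := by
    rw [← hΔw, ← hΔy]
    calc ‖PΔ.eval w - PΔ.eval (y : ℂ)‖ ≤ KΔ * ‖w - (y : ℂ)‖ := hKΔ w y hwle hyle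
      _ ≤ KΔ * (y * τ) := mul_le_mul_of_nonneg_left hwy hKΔ0
      _ = KΔ * y * τ := by ring
  have hΔτ : KΔ * y * τ ≤ Δ₀ / 2 := smallness (mul_nonneg hKΔ0 hy.le) hΔ₀0 hτt₀ ht₀Δ
  have hΔ₀C : ((Δ₀ : ℂ)) ≠ 0 := by exact_mod_cast hΔ₀0.ne'
  have hΔ₀n : ‖(Δ₀ : ℂ)‖ = Δ₀ := by rw [Complex.norm_real, Real.norm_of_nonneg hΔ₀0.le]
  obtain ⟨hΔw0, hΔwlow, hΔinv⟩ := lip_inv (a := ((w - z) ^ 2 + 2 * w + 2 * z + 1) ^ 2) (a₀ := (Δ₀ : ℂ)) (A := KΔ * y)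
    (by positivity) hτ0 hΔ₀C hΔlip (by rw [hΔ₀n]; exact hΔτ)
  rw [hΔ₀n] at hΔwlow hΔinv
  obtain ⟨A, hA⟩ : ∃ A : ℂ, A = Lc / ((w - z) ^ 2 + 2 * w + 2 * z + 1) ^ 2 := ⟨_, rfl⟩
  have hmain : ∀ M : ℕ, 1 ≤ M →
      ‖stripZ₂C 1 (2 * M + c) w (z : ℂ) - A * s' ^ M‖ ≤ 2 * (Ku + Ke') / Δ₀ * ((M : ℝ) + 1) * Θ ^ M := by
    intro M hM
    obtain ⟨M', rfl⟩ : ∃ M', M = M' + 1 := ⟨M - 1, by omega⟩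
    have hdec := Hdec (2 * M' + c)
    rw [show 2 * M' + c + 2 = 2 * (M' + 1) + c by ring, ← hu, ← he] at hdec
    have hsplit : ((w - z) ^ 2 + 2 * w + 2 * z + 1) ^ 2 * (stripZ₂C 1 (2 * (M' + 1) + c) w (z : ℂ) - A * s' ^ (M' + 1))
        = (u (2 * (M' + 1) + c) - Lc * s' ^ (M' + 1)) + e (2 * (M' + 1) + c) := by
      have hc : ((w - z) ^ 2 + 2 * w + 2 * z + 1) ^ 2 * (A * s' ^ (M' + 1)) = Lc * s' ^ (M' + 1) := by
        rw [hA, div_mul_eq_mul_div, mul_comm, div_mul_cancel₀ _ hΔw0]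
      rw [mul_sub, hdec, hc]
      ring
    have hn : ‖((w - z) ^ 2 + 2 * w + 2 * z + 1) ^ 2 * (stripZ₂C 1 (2 * (M' + 1) + c) w (z : ℂ) - A * s' ^ (M' + 1))‖
        ≤ (Ku + Ke') * (((M' + 1 : ℕ) : ℝ) + 1) * Θ ^ (M' + 1) := by
      rw [hsplit]
      refine (norm_add_le _ _).trans ?_
      have h1 := hUb (M' + 1)
      have h2 := hEb (M' + 1)
      have hR'Θp : R' ^ (M' + 1) ≤ Θ ^ (M' + 1) := pow_le_pow_left₀ hR'0.le hR'Θ _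
      have hΘeΘp : Θe ^ (M' + 1) ≤ Θ ^ (M' + 1) := pow_le_pow_left₀ hΘe0 hΘeΘ _
      calc ‖u (2 * (M' + 1) + c) - Lc * s' ^ (M' + 1)‖ + ‖e (2 * (M' + 1) + c)‖
          ≤ Ku * (((M' + 1 : ℕ) : ℝ) + 1) * R' ^ (M' + 1) + Ke' * (((M' + 1 : ℕ) : ℝ) + 1) * Θe ^ (M' + 1) := add_le_add h1 h2
        _ ≤ Ku * (((M' + 1 : ℕ) : ℝ) + 1) * Θ ^ (M' + 1) + Ke' * (((M' + 1 : ℕ) : ℝ) + 1) * Θ ^ (M' + 1) := by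
            have hm0 : (0 : ℝ) ≤ ((M' + 1 : ℕ) : ℝ) + 1 := by positivity
            exact add_le_add (mul_le_mul_of_nonneg_left hR'Θp (mul_nonneg hKu0 hm0))
              (mul_le_mul_of_nonneg_left hΘeΘp (mul_nonneg hKe'0 hm0))
        _ = (Ku + Ke') * (((M' + 1 : ℕ) : ℝ) + 1) * Θ ^ (M' + 1) := by ring
    rw [norm_mul] at hn
    have hq : ‖stripZ₂C 1 (2 * (M' + 1) + c) w (z : ℂ) - A * s' ^ (M' + 1)‖ * (Δ₀ / 2)
        ≤ (Ku + Ke') * (((M' + 1 : ℕ) : ℝ) + 1) * Θ ^ (M' + 1) :=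
      calc ‖stripZ₂C 1 (2 * (M' + 1) + c) w (z : ℂ) - A * s' ^ (M' + 1)‖ * (Δ₀ / 2)
          ≤ ‖stripZ₂C 1 (2 * (M' + 1) + c) w (z : ℂ) - A * s' ^ (M' + 1)‖ * ‖((w - z) ^ 2 + 2 * w + 2 * z + 1) ^ 2‖ :=
            mul_le_mul_of_nonneg_left hΔwlow (norm_nonneg _)
        _ = ‖((w - z) ^ 2 + 2 * w + 2 * z + 1) ^ 2‖ * ‖stripZ₂C 1 (2 * (M' + 1) + c) w (z : ℂ) - A * s' ^ (M' + 1)‖ :=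
            mul_comm _ _
        _ ≤ (Ku + Ke') * (((M' + 1 : ℕ) : ℝ) + 1) * Θ ^ (M' + 1) := hn
    rw [← le_div_iff₀ (by positivity)] at hq
    refine hq.trans (le_of_eq ?_)
    rw [div_div_eq_mul_div]
    ring
  -- === the amplitude is Lipschitz at t = 0 ===
  have hsC : ((s : ℂ)) ≠ 0 := by exact_mod_cast hs0.ne'
  have hDC : ((D : ℂ)) ≠ 0 := by exact_mod_cast hD0.ne'
  have hDn : ‖(D : ℂ)‖ = D := by rw [Complex.norm_real, Real.norm_of_nonneg hD0.le]
  -- data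
  have hu0 : ‖u (2 * 0 + c) - ub₀‖ ≤ K₀ * y * τ := by
    calc ‖u (2 * 0 + c) - ub₀‖ ≤ K₀ * ‖w - (y : ℂ)‖ := by rw [hu, hub₀]; exact hK₀ w y hwle hyle
      _ ≤ K₀ * (y * τ) := mul_le_mul_of_nonneg_left hwy hK₀0
      _ = K₀ * y * τ := by ring
  have hu1 : ‖u (2 * 1 + c) - ub₁‖ ≤ K₁ * y * τ := by
    calc ‖u (2 * 1 + c) - ub₁‖ ≤ K₁ * ‖w - (y : ℂ)‖ := by rw [hu, hub₁]; exact hK₁ w y hwle hyle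
      _ ≤ K₁ * (y * τ) := mul_le_mul_of_nonneg_left hwy hK₁0
      _ = K₁ * y * τ := by ring
  have hu2 : ‖u (2 * 2 + c) - ub₂‖ ≤ K₂ * y * τ := by
    calc ‖u (2 * 2 + c) - ub₂‖ ≤ K₂ * ‖w - (y : ℂ)‖ := by rw [hu, hub₂]; exact hK₂ w y hwle hyle
      _ ≤ K₂ * (y * τ) := mul_le_mul_of_nonneg_left hwy hK₂0
      _ = K₂ * y * τ := by ring
  have hb0 : ‖ub₀‖ ≤ B₀ := by rw [hub₀]; exact hB₀ (y : ℂ) hyle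
  have hb1 : ‖ub₁‖ ≤ B₁ := by rw [hub₁]; exact hB₁ (y : ℂ) hyle
  have hb2 : ‖ub₂‖ ≤ B₂ := by rw [hub₂]; exact hB₂ (y : ℂ) hyle
  -- p = s' − w − z
  have hp : ‖(s' - w - (z : ℂ)) - ((s : ℂ) - y - z)‖ ≤ (L + y) * τ := by
    have e1 : (s' - w - (z : ℂ)) - ((s : ℂ) - y - z) = (s' - (s : ℂ)) - (w - (y : ℂ)) := by ring
    rw [e1]
    calc ‖(s' - (s : ℂ)) - (w - (y : ℂ))‖ ≤ ‖s' - (s : ℂ)‖ + ‖w - (y : ℂ)‖ := norm_sub_le _ _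
      _ ≤ L * τ + y * τ := add_le_add hdisp' hwy
      _ = (L + y) * τ := by ring
  have hyn : ‖(y : ℂ)‖ = y := by rw [Complex.norm_real, Real.norm_of_nonneg hy.le]
  have hzn : ‖(z : ℂ)‖ = z := by rw [Complex.norm_real, Real.norm_of_nonneg hz.le]
  have hp₀ : ‖((s : ℂ) - y - z)‖ ≤ s + y + z := by
    calc ‖((s : ℂ) - y - z)‖ ≤ ‖(s : ℂ) - y‖ + ‖(z : ℂ)‖ := norm_sub_le _ _
      _ ≤ (‖(s : ℂ)‖ + ‖(y : ℂ)‖) + ‖(z : ℂ)‖ := add_le_add (norm_sub_le _ _) le_rfl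
      _ = s + y + z := by rw [hsn, hyn, hzn]
  -- the inverse of s'
  have hLs : L * τ ≤ ‖(s : ℂ)‖ / 2 := by rw [hsn]; linarith only [hLτ, hΘ0]
  obtain ⟨-, -, hsinv⟩ := lip_inv (a := s') (a₀ := (s : ℂ)) (A := L) hL0 hτ0 hsC hdisp' hLs
  rw [hsn] at hsinv
  -- κ = (w z) s'⁻¹
  have hwz : ‖w * (z : ℂ) - (y : ℂ) * z‖ ≤ z * y * τ := by
    rw [← sub_mul, norm_mul, hzn]
    calc ‖w - (y : ℂ)‖ * z ≤ y * τ * z := mul_le_mul_of_nonneg_right hwy hz.le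
      _ = z * y * τ := by ring
  have hyzn : ‖(y : ℂ) * z‖ ≤ y * z := by rw [norm_mul, hyn, hzn]
  have hsinvn : ‖(s : ℂ)⁻¹‖ ≤ 1 / s := by rw [norm_inv, hsn, one_div]
  have hκ : ‖w * (z : ℂ) * s'⁻¹ - (y : ℂ) * z * (s : ℂ)⁻¹‖ ≤ Kκ * τ := by
    have := lip_mul (by positivity) (by positivity) hτ0 hτ1 hwz hsinv hyzn hsinvn
    rw [hKκ]; exact this
  have hκ₀ : ‖(y : ℂ) * z * (s : ℂ)⁻¹‖ ≤ y * z / s := by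
    rw [norm_mul, div_eq_mul_one_div]
    exact mul_le_mul hyzn hsinvn (norm_nonneg _) (by positivity)
  -- the numerator
  have hNum : ‖(u (2 * 2 + c) + (s' - w - (z : ℂ)) * u (2 * 1 + c) + w * (z : ℂ) * s'⁻¹ * u (2 * 0 + c))
      - (ub₂ + ((s : ℂ) - y - z) * ub₁ + (y : ℂ) * z * (s : ℂ)⁻¹ * ub₀)‖ ≤ KNum * τ := by
    have h2 := lip_mul (by positivity) (by positivity) hτ0 hτ1 hp hu1 hp₀ hb1
    have h3 := lip_mul hKκ0 (by positivity) hτ0 hτ1 hκ hu0 hκ₀ hb0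
    have e1 : (u (2 * 2 + c) + (s' - w - (z : ℂ)) * u (2 * 1 + c) + w * (z : ℂ) * s'⁻¹ * u (2 * 0 + c))
        - (ub₂ + ((s : ℂ) - y - z) * ub₁ + (y : ℂ) * z * (s : ℂ)⁻¹ * ub₀)
        = (u (2 * 2 + c) - ub₂) + ((s' - w - (z : ℂ)) * u (2 * 1 + c) - ((s : ℂ) - y - z) * ub₁)
          + (w * (z : ℂ) * s'⁻¹ * u (2 * 0 + c) - (y : ℂ) * z * (s : ℂ)⁻¹ * ub₀) := by ring
    rw [e1, hKNum]
    refine (norm_add₃_le).trans ?_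
    linarith only [hu2, h2, h3]
  have hNum₀n : ‖ub₂ + ((s : ℂ) - y - z) * ub₁ + (y : ℂ) * z * (s : ℂ)⁻¹ * ub₀‖ ≤ NB := by
    rw [hNB]
    refine (norm_add₃_le).trans ?_
    rw [norm_mul, norm_mul]
    have h1 := mul_le_mul hp₀ hb1 (norm_nonneg _) (by positivity)
    have h2 := mul_le_mul hκ₀ hb0 (norm_nonneg _) (by positivity)
    linarith only [hb2, h1, h2]
  -- the denominator
  have hsp : ‖(s' + (s' - w - (z : ℂ))) - ((s : ℂ) + ((s : ℂ) - y - z))‖ ≤ (2 * L + y) * τ := by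
    have e1 : (s' + (s' - w - (z : ℂ))) - ((s : ℂ) + ((s : ℂ) - y - z)) = (s' - (s : ℂ)) + ((s' - (s : ℂ)) - (w - (y : ℂ))) := by
      ring
    rw [e1]
    have h2 : ‖(s' - (s : ℂ)) - (w - (y : ℂ))‖ ≤ L * τ + y * τ := (norm_sub_le _ _).trans (add_le_add hdisp' hwy)
    calc ‖(s' - (s : ℂ)) + ((s' - (s : ℂ)) - (w - (y : ℂ)))‖ ≤ ‖s' - (s : ℂ)‖ + ‖(s' - (s : ℂ)) - (w - (y : ℂ))‖ := norm_add_le _ _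
      _ ≤ L * τ + (L * τ + y * τ) := add_le_add hdisp' h2
      _ = (2 * L + y) * τ := by ring
  have hsp₀ : ‖(s : ℂ) + ((s : ℂ) - y - z)‖ ≤ 2 * s + y + z := by
    calc ‖(s : ℂ) + ((s : ℂ) - y - z)‖ ≤ ‖(s : ℂ)‖ + ‖(s : ℂ) - y - z‖ := norm_add_le _ _
      _ ≤ s + (s + y + z) := by rw [hsn]; exact add_le_add le_rfl hp₀
      _ = 2 * s + y + z := by ring
  have hDen : ‖(s' * (s' + (s' - w - (z : ℂ))) + w * (z : ℂ) * s'⁻¹)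
      - ((s : ℂ) * ((s : ℂ) + ((s : ℂ) - y - z)) + (y : ℂ) * z * (s : ℂ)⁻¹)‖ ≤ KDen * τ := by
    have h1 := lip_mul hL0 (by positivity) hτ0 hτ1 hdisp' hsp (le_of_eq hsn) hsp₀
    have e1 : (s' * (s' + (s' - w - (z : ℂ))) + w * (z : ℂ) * s'⁻¹)
        - ((s : ℂ) * ((s : ℂ) + ((s : ℂ) - y - z)) + (y : ℂ) * z * (s : ℂ)⁻¹)
        = (s' * (s' + (s' - w - (z : ℂ))) - (s : ℂ) * ((s : ℂ) + ((s : ℂ) - y - z)))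
          + (w * (z : ℂ) * s'⁻¹ - (y : ℂ) * z * (s : ℂ)⁻¹) := by ring
    rw [e1, hKDen]
    refine (norm_add_le _ _).trans ?_
    linarith only [h1, hκ]
  have hDen₀ : (s : ℂ) * ((s : ℂ) + ((s : ℂ) - y - z)) + (y : ℂ) * z * (s : ℂ)⁻¹ = (D : ℂ) := by
    rw [← hcof]
    simp only [div_eq_mul_inv]
    ring
  rw [hDen₀] at hDen
  have hDτ : KDen * τ ≤ ‖(D : ℂ)‖ / 2 := by
    rw [hDn]; exact smallness hKDen0 hD0 hτt₀ ht₀D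
  obtain ⟨-, -, hDeninv⟩ := lip_inv (A := KDen) hKDen0 hτ0 hDC hDen hDτ
  rw [hDn] at hDeninv
  have hDinvn : ‖(D : ℂ)⁻¹‖ ≤ 1 / D := by rw [norm_inv, hDn, one_div]
  -- Lc = Num · Den⁻¹
  have hLcform : Lc = (u (2 * 2 + c) + (s' - w - (z : ℂ)) * u (2 * 1 + c) + w * (z : ℂ) * s'⁻¹ * u (2 * 0 + c))
      * (s' * (s' + (s' - w - (z : ℂ))) + w * (z : ℂ) * s'⁻¹)⁻¹ := by
    have e1 : s' ^ 2 + (s' - w - (z : ℂ)) * s' + w * (z : ℂ) / s' = s' * (s' + (s' - w - (z : ℂ))) + w * (z : ℂ) * s'⁻¹ := by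
      rw [div_eq_mul_inv]; ring
    have e2 : u (2 * 2 + c) + (s' - w - (z : ℂ)) * u (2 * 1 + c) + w * (z : ℂ) / s' * u (2 * 0 + c)
        = u (2 * 2 + c) + (s' - w - (z : ℂ)) * u (2 * 1 + c) + w * (z : ℂ) * s'⁻¹ * u (2 * 0 + c) := by
      rw [div_eq_mul_inv]
    rw [hLc, e1, e2, div_eq_mul_inv]
  have hLc₀form : Num₀ / (D : ℂ) = (ub₂ + ((s : ℂ) - y - z) * ub₁ + (y : ℂ) * z * (s : ℂ)⁻¹ * ub₀) * (D : ℂ)⁻¹ := by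
    rw [hNum₀, div_eq_mul_inv]; simp only [div_eq_mul_inv]
  have hLcLip : ‖Lc - Num₀ / (D : ℂ)‖ ≤ KLc * τ := by
    rw [hLcform, hLc₀form, hKLc]
    exact lip_mul hKNum0 (by positivity) hτ0 hτ1 hNum hDeninv hNum₀n hDinvn
  have hLc₀n : ‖Num₀ / (D : ℂ)‖ ≤ NB / D := by
    rw [hLc₀form, norm_mul, div_eq_mul_one_div]
    exact mul_le_mul hNum₀n hDinvn (norm_nonneg _) hNB0
  -- A = Lc · Δ⁻¹
  have hΔinvn : ‖(Δ₀ : ℂ)⁻¹‖ ≤ 1 / Δ₀ := by rw [norm_inv, hΔ₀n, one_div]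
  have hAlip : ‖A - A₀‖ ≤ KA * τ := by
    have e1 : A = Lc * (((w - z) ^ 2 + 2 * w + 2 * z + 1) ^ 2)⁻¹ := by rw [hA, div_eq_mul_inv]
    have e2 : A₀ = Num₀ / (D : ℂ) * ((Δ₀ : ℂ))⁻¹ := by rw [hA₀, div_eq_mul_inv]
    rw [e1, e2, hKA]
    exact lip_mul hKLc0 (by positivity) hτ0 hτ1 hLcLip hΔinv hLc₀n hΔinvn
  have hAn : ‖A‖ ≤ ‖A₀‖ + KA := by
    have h1 : ‖A‖ ≤ ‖A₀‖ + ‖A - A₀‖ := by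
      have := norm_add_le A₀ (A - A₀); rwa [add_sub_cancel] at this
    have h2 : KA * τ ≤ KA * 1 := mul_le_mul_of_nonneg_left hτ1 hKA0
    linarith only [h1, h2, hAlip]
  -- === conclusion ===
  have hKAK : KA ≤ K := by
    rw [hK]
    have h1 : 0 ≤ 2 * (Ku + Ke') / Δ₀ := by positivity
    have h2 : 0 < stripZ₂ 1 c y z := stripZ₂_pos 1 c hy hz
    have h3 : 0 ≤ ‖A₀‖ := norm_nonneg _
    linarith only [h1, h2, h3, hKA0]
  have hAlipK : ‖A - A₀‖ ≤ K * τ := hAlip.trans (mul_le_mul_of_nonneg_right hKAK hτ0)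
  refine ⟨s', A, hF, hdisp', hAlipK, fun M => ?_⟩
  rcases Nat.eq_zero_or_pos M with hM | hM
  · subst hM
    simp only [Nat.mul_zero, pow_zero, mul_one, Nat.cast_zero, zero_add]
    have h1 : ‖stripZ₂C 1 c w (z : ℂ)‖ ≤ stripZ₂ 1 c y z := by
      have := norm_stripZ₂C_le 1 c w (z : ℂ)
      rwa [hwn, hzn] at this
    have hpos : 0 ≤ 2 * (Ku + Ke') / Δ₀ := by positivity
    calc ‖stripZ₂C 1 c w (z : ℂ) - A‖ ≤ ‖stripZ₂C 1 c w (z : ℂ)‖ + ‖A‖ := norm_sub_le _ _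
      _ ≤ stripZ₂ 1 c y z + (‖A₀‖ + KA) := add_le_add h1 hAn
      _ ≤ K := by rw [hK]; linarith only [hpos, hKA0]
  · have h := hmain M hM
    refine h.trans ?_
    have hcoef : 2 * (Ku + Ke') / Δ₀ ≤ K := by
      rw [hK]
      have := stripZ₂_pos 1 c hy hz
      have : 0 ≤ ‖A₀‖ := norm_nonneg _
      linarith only [‹0 < stripZ₂ 1 c y z›, this, hKA0]
    have hnn : 0 ≤ ((M : ℝ) + 1) * Θ ^ M := by positivity
    calc 2 * (Ku + Ke') / Δ₀ * ((M : ℝ) + 1) * Θ ^ M = 2 * (Ku + Ke') / Δ₀ * (((M : ℝ) + 1) * Θ ^ M) := by ring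
      _ ≤ K * (((M : ℝ) + 1) * Θ ^ M) := mul_le_mul_of_nonneg_right hcoef hnn
      _ = K * ((M : ℝ) + 1) * Θ ^ M := by ring

/-! ## §5 ★★★ The amplitude is real and positive -/

/-- ★★★ **COMPLEX TWO-TERM ASYMPTOTICS WITH A REAL, POSITIVE AMPLITUDE.**  In `exists_complex_two_term` the base amplitude `A₀` is REAL and POSITIVE,
`C_{1,2M+c}(y,z)/s^M → A₀` and `|C_{1,2M+c}(y,z) − A₀s^M| ≤ K(M+1)Θ^M` (`s = μ₁(y,z)²`): at `t = 0` the statement forces `s' = s`, `A = A₀`, so `‖C_{1,2M+c}(y,z) − A₀s^M‖ ≤ K(M+1)Θ^M`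
with `Θ < s`, whence the limit; it is positive by Fekete's bound `μ₁^N ≤ K(y)K(z)C_{1,N}` (`pos_of_tendsto_stripZ₂_one_parity`).  This is brick B6c of the
Berry–Esseen programme: for `|t| < t₀`, `C_{1,2M+c}(ye^{it},z) = A(t)s(t)^M(1 + O((M+1)(Θ/‖s(t)‖)^M))` with `A(t) = A₀ + O(t)`, `A₀ > 0`.
[cite: BeatonBousquetMelouDeGierDuminilCopinGuttmann2014, §3.2 Proposition 6 (arXiv v5 p. 10; lane statement); MadrasSlade1993, §1.1 eq. (1.1.4) p. 5; Stanley2012EC1, §4.1 Theorem 4.1.1 (iii)] -/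
theorem exists_complex_two_term_real_amplitude (hy : 0 < y) (hz : 0 < z) (c : ℕ) :
    ∃ A₀ L t₀ K Θ : ℝ, 0 < A₀ ∧ 0 ≤ L ∧ 0 < t₀ ∧ 0 ≤ K ∧ 0 ≤ Θ ∧ Θ < stripMuY₂ 1 y z ^ 2 - L * t₀ ∧
      Tendsto (fun M : ℕ => stripZ₂ 1 (2 * M + c) y z / (stripMuY₂ 1 y z ^ 2) ^ M) atTop (𝓝 A₀) ∧
      (∀ M : ℕ, |stripZ₂ 1 (2 * M + c) y z - A₀ * (stripMuY₂ 1 y z ^ 2) ^ M| ≤ K * ((M : ℝ) + 1) * Θ ^ M) ∧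
      ∀ t : ℝ, |t| < t₀ → ∃ s' A : ℂ, twoWallCubic y z s' t = 0 ∧
        ‖s' - ((stripMuY₂ 1 y z ^ 2 : ℝ) : ℂ)‖ ≤ L * |t| ∧ ‖A - (A₀ : ℂ)‖ ≤ K * |t| ∧
        ∀ M : ℕ, ‖stripZ₂C 1 (2 * M + c) ((y : ℂ) * cexp ((t : ℂ) * I)) (z : ℂ) - A * s' ^ M‖ ≤ K * ((M : ℝ) + 1) * Θ ^ M := by
  obtain ⟨A₀, L, t₀, K, Θ, hL0, ht₀, hK0, hΘ0, hΘs, H⟩ := exists_complex_two_term hy hz c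
  obtain ⟨hys, -⟩ := lt_stripMuY₂_one_sq₂ hy hz
  set s := stripMuY₂ 1 y z ^ 2 with hs
  have hs0 : 0 < s := hy.trans hys
  have hμ : 0 < stripMuY₂ 1 y z := stripMuY₂_pos 1 hy hz
  -- t = 0: s' = s and A = A₀
  obtain ⟨s₀, A', -, hd0, hA0, hM0⟩ := H 0 (by simpa using ht₀)
  have hs₀ : s₀ = (s : ℂ) := by
    have : ‖s₀ - (s : ℂ)‖ ≤ 0 := by simpa using hd0
    exact sub_eq_zero.1 (norm_le_zero_iff.1 this)
  have hA' : A' = A₀ := by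
    have : ‖A' - A₀‖ ≤ 0 := by simpa using hA0
    exact sub_eq_zero.1 (norm_le_zero_iff.1 this)
  have hreal : ∀ M : ℕ, ‖((stripZ₂ 1 (2 * M + c) y z : ℝ) : ℂ) - A₀ * (s : ℂ) ^ M‖ ≤ K * ((M : ℝ) + 1) * Θ ^ M := by
    intro M
    have h := hM0 M
    rw [hs₀, hA'] at h
    simpa [stripZ₂C_ofReal] using h
  -- the limit
  have hΘs' : Θ < s := by
    have : 0 ≤ L * t₀ := mul_nonneg hL0 ht₀.le
    linarith
  have hq0 : 0 ≤ Θ / s := div_nonneg hΘ0 hs0.le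
  have hq1 : Θ / s < 1 := (div_lt_one hs0).2 hΘs'
  have hlimC : Tendsto (fun M : ℕ => (((stripZ₂ 1 (2 * M + c) y z / s ^ M : ℝ) : ℂ))) atTop (𝓝 A₀) := by
    rw [tendsto_iff_norm_sub_tendsto_zero]
    have hbound : ∀ M : ℕ, ‖((stripZ₂ 1 (2 * M + c) y z / s ^ M : ℝ) : ℂ) - A₀‖ ≤ K * ((M : ℝ) + 1) * (Θ / s) ^ M := by
      intro M
      have hsM : (0 : ℝ) < s ^ M := pow_pos hs0 M
      have hsMC : ((s : ℂ)) ^ M ≠ 0 := pow_ne_zero _ (by exact_mod_cast hs0.ne')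
      have e : ((stripZ₂ 1 (2 * M + c) y z / s ^ M : ℝ) : ℂ) - A₀
          = (((stripZ₂ 1 (2 * M + c) y z : ℝ) : ℂ) - A₀ * (s : ℂ) ^ M) / (s : ℂ) ^ M := by
        push_cast
        rw [eq_div_iff hsMC, sub_mul, div_mul_cancel₀ _ hsMC]
      rw [e, norm_div, norm_pow, Complex.norm_real, Real.norm_of_nonneg hs0.le, div_le_iff₀ hsM]
      calc ‖((stripZ₂ 1 (2 * M + c) y z : ℝ) : ℂ) - A₀ * (s : ℂ) ^ M‖ ≤ K * ((M : ℝ) + 1) * Θ ^ M := hreal M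
        _ = K * ((M : ℝ) + 1) * (Θ / s) ^ M * s ^ M := by
            rw [div_pow, mul_assoc (K * ((M : ℝ) + 1)), div_mul_cancel₀ _ hsM.ne']
    have hlim0 : Tendsto (fun M : ℕ => K * ((M : ℝ) + 1) * (Θ / s) ^ M) atTop (𝓝 0) := by
      have h1 := tendsto_self_mul_const_pow_of_lt_one hq0 hq1
      have h2 := tendsto_pow_atTop_nhds_zero_of_lt_one hq0 hq1
      have h3 : Tendsto (fun M : ℕ => K * ((M : ℝ) * (Θ / s) ^ M + (Θ / s) ^ M)) atTop (𝓝 (K * (0 + 0))) :=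
        (h1.add h2).const_mul K
      rw [add_zero, mul_zero] at h3
      refine h3.congr fun M => ?_
      ring
    exact squeeze_zero (fun M => norm_nonneg _) hbound hlim0
  -- `A₀` is real
  have him : A₀.im = 0 := by
    have h1 : Tendsto (fun M : ℕ => (((stripZ₂ 1 (2 * M + c) y z / s ^ M : ℝ) : ℂ)).im) atTop (𝓝 A₀.im) :=
      (Complex.continuous_im.tendsto _).comp hlimC
    have h2 : (fun M : ℕ => (((stripZ₂ 1 (2 * M + c) y z / s ^ M : ℝ) : ℂ)).im) = fun _ => 0 :=
      funext fun M => Complex.ofReal_im _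
    rw [h2] at h1
    exact tendsto_nhds_unique h1 tendsto_const_nhds
  have hre : Tendsto (fun M : ℕ => stripZ₂ 1 (2 * M + c) y z / s ^ M) atTop (𝓝 A₀.re) := by
    have h1 : Tendsto (fun M : ℕ => (((stripZ₂ 1 (2 * M + c) y z / s ^ M : ℝ) : ℂ)).re) atTop (𝓝 A₀.re) :=
      (Complex.continuous_re.tendsto _).comp hlimC
    exact h1.congr fun M => Complex.ofReal_re _
  have hA₀eq : (A₀.re : ℂ) = A₀ := by
    apply Complex.ext <;> simp [him]
  -- positivity via Fekete
  have hpar : Tendsto (fun M : ℕ => stripZ₂ 1 (2 * M + c) y z / stripMuY₂ 1 y z ^ (2 * M + c)) atTop (𝓝 (A₀.re / stripMuY₂ 1 y z ^ c)) := by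
    refine (hre.div_const (stripMuY₂ 1 y z ^ c)).congr fun M => ?_
    rw [hs, ← pow_mul, pow_add, div_div]
  have hpos : 0 < A₀.re := by
    have h := pos_of_tendsto_stripZ₂_one_parity hy hz c hpar
    have hμc : 0 < stripMuY₂ 1 y z ^ c := pow_pos hμ c
    have := (div_pos_iff_of_pos_right hμc).1 h
    exact this
  have hrealb : ∀ M : ℕ, |stripZ₂ 1 (2 * M + c) y z - A₀.re * s ^ M| ≤ K * ((M : ℝ) + 1) * Θ ^ M := by
    intro M
    have h := hreal M
    rw [← hA₀eq] at h
    have e : ((stripZ₂ 1 (2 * M + c) y z : ℝ) : ℂ) - (A₀.re : ℂ) * (s : ℂ) ^ M = ((stripZ₂ 1 (2 * M + c) y z - A₀.re * s ^ M : ℝ) : ℂ) := by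
      push_cast; ring
    rw [e, Complex.norm_real, Real.norm_eq_abs] at h
    exact h
  refine ⟨A₀.re, L, t₀, K, Θ, hpos, hL0, ht₀, hK0, hΘ0, hΘs, hre, hrealb, fun t ht => ?_⟩
  obtain ⟨s', A, hF, hd, hA, hM⟩ := H t ht
  exact ⟨s', A, hF, hd, by rw [hA₀eq]; exact hA, hM⟩

end WidthOneYZ

end Literature.Probability.RandomPlanarGeometry.SAW.HexBW

end
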